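import Summits.BirchSwinnertonDyer.BirchSwinnertonDyer.Theses.PrintCFram
import Summits.BirchSwinnertonDyer.Rank1Residual.Partition.MainConjecturesCMAnyOrder
import Summits.BirchSwinnertonDyer.Rank1Residual.Partition.CornersCMDecide
import Summits.BirchSwinnertonDyer.Rank1Residual.X12.CMIsogenyInvariance
import HarnessLib

/-!
# Route PrintCFram, crux C1 `CMRamifiedThreeBSD` (item stmt-BirchSwinnertonDyer-20371): the
# `j = 0` REDUCTION — stub 1 of the registered BC3 skeleton PROVED, and the crux from the remaining
# stub BY NAME (cell `bsd-print-cfram`, seat p4, PLAN §2 p4 (b) / planner TURNKEY 13:52:20Z)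

HONEST FRAMING (cell `bsd-print-cfram`, run/shared/lean/pub/bsd-print-cfram/, D-0131 (2) print
tier; verbatim in every file of the seat): the cell works the partition leaf
`CornerF ∧ p ramified in the CM field K` (LADDER-BSD row K7r = B13; W-ALL row 12r) in PARTITION
currency — a leaf or a cell counts only when its theorem is in the kernel BY NAME. The crux C1 of
route `PrintCFram` is the `p = 3` slice of that leaf with the four refereed facts as antecedents:
`Summit.BirchSwinnertonDyer.BirchSwinnertonDyer.Theses.PrintCFram.CMRamifiedThreeBSD`. The planner's
BC3 birth skeleton (item evidence `birth_pub.lean`, sha 4513f813…, `ledger skeleton check` OK)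
composes it from two named stubs via the tree's `Rank1Residual.bsdp_of_isIsogenous_maximalOrder`
(Cassels + GZK + modularity transport to a maximal-order model):
* `stub_jZeroOfMaximalIsogenous` (S): a curve `W'` with `j(W') ∈ maximalCMJInvariants` that is
  `ℚ`-isogenous to a CM curve `W` with `3` ramified in its CM field has `j(W') = 0` — PROVED HERE
  (exact registered name and signature, §1): `CMRamified` and `HasCM` are `ℚ`-isogeny invariants
  (`X12.cmRamified_iff_of_isIsogenous`, `X12.hasCM_iff_of_isIsogenous`), `CMRamified W' 3 ⟺ d_K = −3`
  (`Rank1Residual.cmRamified_three_iff_of_hasCM`), and `0` is the only one of the nine maximal CM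
  `j`-invariants with `d_K = −3` (table `cmFieldDiscrOfJ`, kernel evaluation).
* `stub_jZeroRankOneBSDThree` (XL — the CONTENT of the `@3` slice: BSD(E,3) for every globally
  minimal rank-one curve with `j = 0`, granted the four facts): NOT proved anywhere; no class-wide
  theorem is in print (bsd-wall-cm K12R3-SCOPING-v1 §3; printed rungs = the Kriz–Li / Hu–Shu–Yin /
  Kezuka–Li / Shu–Yin families; per-class certificates `X12/JZeroThreeRecords*.lean`). It enters §2
  as the HYPOTHESIS `hJ0`.
§2 `CMRamifiedThreeBSD_of_jZeroRankOneBSDThree : (stub 2 statement) → CMRamifiedThreeBSD` is the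
skeleton's composition with stub 1 discharged — «C1 ⟸ BSD(3) for rank-one `j = 0` globally minimal
curves» BY NAME. (Sibling, seat p4: `X12/JZeroThreeIsogenyNormalForm.lean` gives the explicit Vélu
normal form `W ~ y² = x³ + k` and the IFF forms of this reduction.) No named fact is introduced;
nothing is asserted about any curve; beyond-print: NO.

References: PLAN.md §1 C1 / §2 p4 (b); item stmt-BirchSwinnertonDyer-20371 (skeleton sha 4513f813…);
`Partition/MainConjecturesCMAnyOrder.lean` §1; `X12/CMIsogenyInvariance.lean` §3;
[cite: SilvermanATAEC1994, App. A §3 (table of CM j-invariants)]; [cite: MilneADT2006, Thm. I.7.3];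
[cite: Miller2011LMS, §1 and Def. 1.1].
-/

set_option linter.dupNamespace false
set_option autoImplicit false

noncomputable section

open scoped Classical

open WeierstrassCurve Literature.NumberTheory.EllipticCurves
  Literature.NumberTheory.EllipticCurves.ModularForms
  Literature.NumberTheory.EllipticCurves.Rank1Residual
  Summit.BirchSwinnertonDyer.Rank1Residual

/-! ## §1 Stub 1 of the BC3 skeleton, by its registered name and signature -/

namespace Summit.BirchSwinnertonDyer.BirchSwinnertonDyer.Cruxes.CMRamifiedThreeBSD.Birth

/-- **Stub 1 (`stub_jZeroOfMaximalIsogenous`) PROVED.** If `W/ℚ` has CM with `3` ramified in the CM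
field and `W ~_ℚ W'` with `j(W') ∈ maximalCMJInvariants`, then `j(W') = 0`: by isogeny invariance
of CM and of `CMRamified` (`X12/CMIsogenyInvariance.lean`) `CMRamified W' 3`, i.e. `d_K(W') = −3`
(`cmRamified_three_iff_of_hasCM`), and among `{0, 1728, −3375, 8000, −32768, −884736, −884736000,
−147197952000, −262537412640768000}` only `0` has `d_K = −3` (kernel evaluation of `cmFieldDiscrOfJ`).
[cite: SilvermanATAEC1994, App. A §3 (table of CM j-invariants)] -/
theorem stub_jZeroOfMaximalIsogenous : ∀ (W W' : WeierstrassCurve ℚ) [W.IsElliptic] [W'.IsElliptic],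
    WeierstrassCurve.IsIsogenous W W' → W.HasCM → CMRamified W 3 → W'.j ∈ maximalCMJInvariants →
      W'.j = 0 := by
  intro W W' _ _ hiso hCM hram hj'
  have hCM' : W'.HasCM := (X12.hasCM_iff_of_isIsogenous hiso).mp hCM
  have hram' : CMRamified W' 3 := (X12.cmRamified_iff_of_isIsogenous hiso hCM 3).mp hram
  have hd : cmFieldDiscrOfJ W'.j = -3 := (cmRamified_three_iff_of_hasCM hCM').mp hram'
  simp only [maximalCMJInvariants, Finset.mem_insert, Finset.mem_singleton] at hj'
  rcases hj' with h | h | h | h | h | h | h | h | h <;> rw [h] at hd ⊢ <;> norm_num [cmFieldDiscrOfJ] at hd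

end Summit.BirchSwinnertonDyer.BirchSwinnertonDyer.Cruxes.CMRamifiedThreeBSD.Birth

/-! ## §2 The crux from the remaining stub, by name -/

namespace Summit.BirchSwinnertonDyer.BirchSwinnertonDyer.Theorems.PrintCFram

open Summit.BirchSwinnertonDyer.BirchSwinnertonDyer.Cruxes.CMRamifiedThreeBSD.Birth

/-- **C1 ⟸ the `j = 0` statement.** Granted the remaining stub of the skeleton AS A HYPOTHESIS —
`hJ0 :` (the four refereed facts) `→ ∀ W₀` globally minimal elliptic, `j(W₀) = 0 → r_an(W₀) = 1 →
BSD(W₀, 3)` (= `stub_jZeroRankOneBSDThree`, OPEN, the content of the `@3` slice) — the crux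
`CMRamifiedThreeBSD` of route PrintCFram follows: a CM curve of analytic rank one with `3` ramified is
`ℚ`-isogenous to a globally minimal maximal-order model (`Rank1Residual.bsdp_of_isIsogenous_maximalOrder`:
Cassels `hCassels`, modularity `hmod`, GZK `hGZK`), which has `j = 0` (§1) and the same analytic rank
(Faltings). The skeleton's composition verbatim, with stub 1 discharged. [cite: MilneADT2006, Thm. I.7.3]
[cite: Miller2011LMS, §1 and Def. 1.1] -/
theorem CMRamifiedThreeBSD_of_jZeroRankOneBSDThree
    (hJ0 : WeierstrassCurve.hasEntireLFunction_rat → GrossZagier1986_thm_I_7_3 →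
      rank_eq_analyticRank_of_analyticRank_le_one → WeierstrassCurve.bsdRHS_eq_of_isIsogenous →
      ∀ (W₀ : WeierstrassCurve ℚ) [W₀.IsElliptic] [W₀.IsGloballyMinimal],
        W₀.j = 0 → W₀.analyticRank = 1 → BSDp W₀ 3) :
    Summit.BirchSwinnertonDyer.BirchSwinnertonDyer.Theses.PrintCFram.CMRamifiedThreeBSD := by
  intro hmod hGZ hGZK hCassels W _ _ hCM hr hram
  haveI : Fact (Nat.Prime 3) := ⟨Nat.prime_three⟩
  exact bsdp_of_isIsogenous_maximalOrder hCassels hmod hGZK hCM (le_of_eq hr)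
    fun W' _ _ hiso hj' hr' =>
      hJ0 hmod hGZ hGZK hCassels W' (stub_jZeroOfMaximalIsogenous W W' hiso hCM hram hj') (hr'.trans hr)

/-- **Conversely the crux gives the `j = 0` statement back** (a `j = 0` curve has CM with `3`
ramified: `hasCM_of_j_eq_zero`, `cmFieldDiscrOfJ 0 = −3`), so C1 ⟺ stub 2: the reduction loses
nothing. [folklore] -/
theorem jZeroRankOneBSDThree_of_CMRamifiedThreeBSD
    (h : Summit.BirchSwinnertonDyer.BirchSwinnertonDyer.Theses.PrintCFram.CMRamifiedThreeBSD) :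
    WeierstrassCurve.hasEntireLFunction_rat → GrossZagier1986_thm_I_7_3 →
      rank_eq_analyticRank_of_analyticRank_le_one → WeierstrassCurve.bsdRHS_eq_of_isIsogenous →
      ∀ (W₀ : WeierstrassCurve ℚ) [W₀.IsElliptic] [W₀.IsGloballyMinimal],
        W₀.j = 0 → W₀.analyticRank = 1 → BSDp W₀ 3 := by
  intro hmod hGZ hGZK hCassels W₀ _ _ hj hr
  have hCM : W₀.HasCM := W₀.hasCM_of_j_eq_zero hj
  have hram : CMRamified W₀ 3 := by
    change ((3 : ℕ) : ℤ) ∣ cmFieldDiscrOfJ W₀.j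
    rw [hj]
    norm_num [cmFieldDiscrOfJ]
  exact h hmod hGZ hGZK hCassels W₀ hCM hr hram

/-- **C1 ⟺ its `j = 0` restriction** (the two directions together). [folklore] -/
theorem CMRamifiedThreeBSD_iff_jZeroRankOneBSDThree :
    Summit.BirchSwinnertonDyer.BirchSwinnertonDyer.Theses.PrintCFram.CMRamifiedThreeBSD ↔
      (WeierstrassCurve.hasEntireLFunction_rat → GrossZagier1986_thm_I_7_3 →
        rank_eq_analyticRank_of_analyticRank_le_one → WeierstrassCurve.bsdRHS_eq_of_isIsogenous →
        ∀ (W₀ : WeierstrassCurve ℚ) [W₀.IsElliptic] [W₀.IsGloballyMinimal],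
          W₀.j = 0 → W₀.analyticRank = 1 → BSDp W₀ 3) :=
  ⟨jZeroRankOneBSDThree_of_CMRamifiedThreeBSD, CMRamifiedThreeBSD_of_jZeroRankOneBSDThree⟩

end Summit.BirchSwinnertonDyer.BirchSwinnertonDyer.Theorems.PrintCFram

end
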